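import Literature.Probability.LatticeModels.IsingTranslationInvariance
import HarnessLib

/-!
# Mixing of the plus state on spin products

Trunk G02 (T-STATMECH), topic `Probability/LatticeModels`, namespace `Literature.StatMech`. For the
nearest-neighbour Ising model on `ℤ^d`, `β, h ≥ 0`, and finite `A, B ⊆ ℤ^d`:

`lim_{‖x‖→∞} ⟨σ_A σ_{B+x}⟩⁺_{β,h} = ⟨σ_A⟩⁺_{β,h} ⟨σ_B⟩⁺_{β,h}`
(`tendsto_plusCorr_symmDiff_shift`, along the cofinite filter of `ℤ^d`), the mixing property of
the plus state on the even/odd spin products, as used by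

* M. Aizenman, H. Duminil-Copin, V. Sidoravicius, *Random currents and continuity of Ising
  model's spontaneous magnetization*, Comm. Math. Phys. **334** (2015), proof of Thm. 2.3, R3
  (ergodicity of the infinite-volume random currents), via Prop. A.1 (App. A, p. 15 of
  arXiv:1311.1937v3): "the state `⟨⋯⟩⁺_β` is ergodic and mixing, in the sense that for any pair of
  local functions `F, G`, `lim_{‖x‖→∞} ⟨F × G ∘ τ_x⟩⁺_β = ⟨F⟩⁺_β ⟨G⟩⁺_β`", whose proof "is based on
  the Griffith inequality";
* S. Friedli, Y. Velenik, *Statistical Mechanics of Lattice Systems* (CUP 2017), Exercise 3.15,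
  p. 115 ("`⟨·⟩⁺_{β,h}` has short-range correlations"), whose solution (App. C) the tree's
  `twoPointPlus_tendsto_spontaneousMagnetization_sq_holds` (`OnsagerYang.lean`, the case
  `A = B = {0}`) follows; the present file is the same argument for general `A`, `B`.

## Proof

Lower bound, for every `x`: GKS II in infinite volume (`plusCorr_mul_le`) and translation
invariance (`plusCorr_shift`): `⟨σ_A⟩⁺⟨σ_B⟩⁺ = ⟨σ_A⟩⁺⟨σ_{B+x}⟩⁺ ≤ ⟨σ_{A ∆ (B+x)}⟩⁺`.
Upper bound (`plusCorr_union_shift_le`): for `A, B ⊆ Λ_L` and `‖x‖_∞ ≥ 2L+2` the volumes `Λ_L` and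
`x + Λ_L` are disjoint and not joined by any edge; shrinking the volume to their union raises the
plus correlation (GKS, `isingCorr_plus_le_of_subset`), and there the two spin products are
independent (`isingExpect_fixed_mul_of_separated`) with `⟨σ_{B+x}⟩⁺_{x+Λ_L} = ⟨σ_B⟩⁺_{Λ_L}`
(translation covariance); finally `⟨σ_A⟩⁺_{Λ_L}⟨σ_B⟩⁺_{Λ_L} → ⟨σ_A⟩⁺⟨σ_B⟩⁺` as `L → ∞`.

## Mathlib status

Anchors: `Filter.cofinite`, `Finset.eventually_cofinite_notMem`, `tendsto_order`; tree:
`plusCorr_mul_le`, `isingCorr_plus_le_of_subset`, `plusCorr_le_isingCorr_plus_box`,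
`hasBoxLimit_isingCorr_plus_holds` (`GKSInequalities.lean`), `isingExpect_fixed_mul_of_separated`,
`isingExpect_fixed_eq_of_separated` (`IsingConsistency.lean`), `isingCorr_plus_map_shift`,
`map_shift_box_subset`, `mem_map_shift_iff'`, `Site.supNorm_sub_le_one_of_adj` (`OnsagerYang.lean`,
`PlusStateFKG.lean`), `plusCorr_shift` (`IsingTranslationInvariance.lean`),
`spinProduct_mul_spinProduct` (`GriffithsMonotonicity.lean`).
-/

noncomputable section

open MeasureTheory Filter Topology Finset Literature.Probability.LatticeModels Literature.Probability.Percolation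
open scoped symmDiff

namespace Literature.Probability.LatticeModels

variable (d : ℕ)

/-- A spin product depends only on the spins in its index set. [folklore] -/
theorem spinProduct_congr_of_forall {A : Finset (Site d)} {σ σ' : SpinConfig (Site d)}
    (h : ∀ y ∈ A, σ y = σ' y) : spinProduct A σ = spinProduct A σ' :=
  Finset.prod_congr rfl fun y hy => by simp only [spinAt, h y hy]

/-- Far translates are separated: for `y ∈ Λ_L`, `z ∈ x + Λ_L` and `‖x‖_∞ ≥ 2L+2`,
`‖z - y‖_∞ ≥ 2`. [folklore] -/
theorem two_le_supNorm_sub_of_mem_box {L : ℕ} {x y z : Site d} (hx : 2 * L + 2 ≤ Site.supNorm x)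
    (hy : y ∈ box d L) (hz : z ∈ (box d L).map (Site.shift x).toEmbedding) :
    2 ≤ Site.supNorm (z - y) := by
  rw [mem_box_iff_supNorm_le] at hy
  rw [mem_map_shift_iff', mem_box_iff_supNorm_le] at hz
  have h1 := Site.supNorm_add_le (x - z) (z - y)
  have h2 := Site.supNorm_add_le (x - z + (z - y)) y
  have h3 : x - z + (z - y) + y = x := by abel
  rw [h3] at h2
  rw [Site.supNorm_sub_comm] at hz
  omega

/-- **Decoupling bound for far translates** (Friedli–Velenik 2017, solution of Exercise 3.15,
App. C, with GKS in place of FKG): for `β, h ≥ 0`, `A, B ⊆ Λ_L` and `‖x‖_∞ ≥ 2L + 2`,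
`⟨σ_{A ∪ (B+x)}⟩⁺_{β,h} ≤ ⟨σ_A⟩⁺_{Λ_L;β,h} ⟨σ_B⟩⁺_{Λ_L;β,h}`. [cite: FriedliVelenik2017, Exercise 3.15 (solution, App. C)] -/
theorem plusCorr_union_shift_le {β h : ℝ} (hβ : 0 ≤ β) (hh : 0 ≤ h) {L : ℕ} {A B : Finset (Site d)}
    (hA : A ⊆ box d L) (hB : B ⊆ box d L) {x : Site d} (hx : 2 * L + 2 ≤ Site.supNorm x) :
    plusCorr d β h (A ∪ B.map (Site.shift x).toEmbedding) ≤
      isingCorr (zdGraph d) (box d L) β h .plus A * isingCorr (zdGraph d) (box d L) β h .plus B := by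
  -- the two volumes
  set W₀ : Finset (Site d) := box d L with hW₀
  set W₁ : Finset (Site d) := (box d L).map (Site.shift x).toEmbedding with hW₁
  set W : Finset (Site d) := W₀ ∪ W₁ with hW
  set Bx : Finset (Site d) := B.map (Site.shift x).toEmbedding with hBx
  have hBx : Bx ⊆ W₁ := Finset.map_subset_map.2 hB
  have hfar : ∀ y ∈ W₀, ∀ z ∈ W₁, 2 ≤ Site.supNorm (z - y) := fun y hy z hz =>
    two_le_supNorm_sub_of_mem_box d hx hy hz
  have hdisj : Disjoint W₀ W₁ := by
    rw [Finset.disjoint_left]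
    intro y hy hy'
    have h' := hfar y hy y hy'
    rw [sub_self, Site.supNorm_eq_zero_iff.2 rfl] at h'
    omega
  have hsep : ∀ y ∈ W₀, ∀ z ∈ W₁, ¬(zdGraph d).Adj y z := by
    intro y hy z hz hadj
    have h1 := Site.supNorm_sub_le_one_of_adj hadj
    rw [Site.supNorm_sub_comm] at h1
    have h2 := hfar y hy z hz
    omega
  have hWdiff₀ : W \ W₀ = W₁ := by
    rw [hW, Finset.union_sdiff_left, Finset.sdiff_eq_self_of_disjoint hdisj.symm]
  have hWdiff₁ : W \ W₁ = W₀ := by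
    rw [hW, Finset.union_sdiff_right, Finset.sdiff_eq_self_of_disjoint hdisj]
  -- `W ⊆ Λ_M` for `M` large, and `⟨σ_{A ∪ Bx}⟩⁺ ≤ ⟨σ_{A ∪ Bx}⟩⁺_{Λ_M} ≤ ⟨σ_{A ∪ Bx}⟩⁺_W`
  set M : ℕ := L + Site.supNorm x with hM
  have hW₀M : W₀ ⊆ box d M := box_mono d (by omega)
  have hW₁M : W₁ ⊆ box d M := map_shift_box_subset L x
  have hWM : W ⊆ box d M := Finset.union_subset hW₀M hW₁M
  have hABW : A ∪ Bx ⊆ W := Finset.union_subset_union hA hBx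
  have h1 : plusCorr d β h (A ∪ Bx) ≤ isingCorr (zdGraph d) (box d M) β h .plus (A ∪ Bx) :=
    plusCorr_le_isingCorr_plus_box hβ hh (hABW.trans hWM)
  have h2 : isingCorr (zdGraph d) (box d M) β h .plus (A ∪ Bx) ≤ isingCorr (zdGraph d) W β h .plus (A ∪ Bx) :=
    isingCorr_plus_le_of_subset (zdGraph d) hβ hh hABW hWM
  -- factorisation in `W`
  have hAB : Disjoint A Bx := by
    rw [Finset.disjoint_left]
    exact fun y hy hy' => Finset.disjoint_left.1 hdisj (hA hy) (hBx hy')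
  have hprod : spinProduct (A ∪ Bx) = fun σ => spinProduct A σ * spinProduct Bx σ := by
    funext σ
    rw [spinProduct_mul_spinProduct, Finset.symmDiff_eq_union hAB]
  have hdepA : ∀ σ σ' : SpinConfig (Site d), (∀ y ∈ W₀, σ y = σ' y) →
      spinProduct A σ = spinProduct A σ' := fun σ σ' hσ =>
    spinProduct_congr_of_forall d fun y hy => hσ y (hA hy)
  have hdepB : ∀ σ σ' : SpinConfig (Site d), (∀ y ∈ W \ W₀, σ y = σ' y) →
      spinProduct Bx σ = spinProduct Bx σ' := fun σ σ' hσ =>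
    spinProduct_congr_of_forall d fun y hy => hσ y (hWdiff₀ ▸ hBx hy)
  have hdepB' : ∀ σ σ' : SpinConfig (Site d), (∀ y ∈ W₁, σ y = σ' y) →
      spinProduct Bx σ = spinProduct Bx σ' := fun σ σ' hσ =>
    spinProduct_congr_of_forall d fun y hy => hσ y (hBx hy)
  have hsep' : ∀ y ∈ W₀, ∀ z ∈ W \ W₀, ¬(zdGraph d).Adj y z := by
    rw [hWdiff₀]; exact hsep
  have hsep'' : ∀ z ∈ W₁, ∀ y ∈ W \ W₁, ¬(zdGraph d).Adj z y := by
    rw [hWdiff₁]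
    exact fun z hz y hy hadj => hsep y hy z hz hadj.symm
  have h3 : isingCorr (zdGraph d) W β h .plus (A ∪ Bx) =
      isingCorr (zdGraph d) W₀ β h .plus A * isingCorr (zdGraph d) W₁ β h .plus Bx := by
    have hmul := isingExpect_fixed_mul_of_separated (zdGraph d) Finset.subset_union_left
      hsep' (1 : SpinConfig (Site d)) β h (measurable_spinProduct A) (measurable_spinProduct Bx)
      hdepA hdepB
    have hBeq := isingExpect_fixed_eq_of_separated (zdGraph d) Finset.subset_union_right
      hsep'' (1 : SpinConfig (Site d)) β h (measurable_spinProduct Bx) hdepB'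
    rw [isingCorr, hprod, isingCorr, isingCorr]
    rw [hBeq] at hmul
    exact hmul
  -- translation: `⟨σ_{B+x}⟩⁺_{x+Λ_L} = ⟨σ_B⟩⁺_{Λ_L}`
  have h4 : isingCorr (zdGraph d) W₁ β h .plus Bx = isingCorr (zdGraph d) W₀ β h .plus B :=
    isingCorr_plus_map_shift x (box d L) B β h
  calc plusCorr d β h (A ∪ Bx) ≤ isingCorr (zdGraph d) W β h .plus (A ∪ Bx) := h1.trans h2
    _ = isingCorr (zdGraph d) (box d L) β h .plus A * isingCorr (zdGraph d) (box d L) β h .plus B := by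
        rw [h3, h4]

/-- **Mixing of the plus state on spin products** (ADS15 Prop. A.1, first bullet, at
`F = σ_A`, `G = σ_B`; Friedli–Velenik 2017, Exercise 3.15): for the nearest-neighbour model on
`ℤ^d`, `β, h ≥ 0` and finite `A, B`,
`⟨σ_{A ∆ (B+x)}⟩⁺_{β,h} → ⟨σ_A⟩⁺_{β,h} ⟨σ_B⟩⁺_{β,h}` as `x → ∞` in `ℤ^d` (for `x` large `A` and
`B + x` are disjoint and `σ_{A ∆ (B+x)} = σ_A σ_{B+x}`). [cite: AizenmanDuminilCopinSidoraviciusCMP2015, Prop. A.1 (App. A)] -/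
theorem tendsto_plusCorr_symmDiff_shift {β h : ℝ} (hβ : 0 ≤ β) (hh : 0 ≤ h)
    (A B : Finset (Site d)) :
    Tendsto (fun x : Site d => plusCorr d β h (A ∆ B.map (Site.shift x).toEmbedding)) cofinite
      (𝓝 (plusCorr d β h A * plusCorr d β h B)) := by
  set p := plusCorr d β h A * plusCorr d β h B with hp
  -- the finite-volume products converge to `p`
  set a : ℕ → ℝ := fun L => isingCorr (zdGraph d) (box d L) β h .plus A *
    isingCorr (zdGraph d) (box d L) β h .plus B with ha
  have ha_tend : Tendsto a atTop (𝓝 p) :=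
    (hasBoxLimit_isingCorr_plus_holds hβ hh A).mul (hasBoxLimit_isingCorr_plus_holds hβ hh B)
  obtain ⟨L₁, hL₁⟩ := exists_forall_subset_box d (A ∪ B)
  rw [tendsto_order]
  constructor
  · -- lower bound, for every `x`: GKS II and translation invariance
    intro b hb
    refine Filter.Eventually.of_forall fun x => hb.trans_le ?_
    have h := plusCorr_mul_le hβ hh A (B.map (Site.shift x).toEmbedding)
    rwa [plusCorr_shift d hβ hh x B] at h
  · -- upper bound for `x` outside a box
    intro b hb
    obtain ⟨L, hL⟩ := ((ha_tend.eventually (gt_mem_nhds hb)).and (eventually_ge_atTop L₁)).exists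
    filter_upwards [(box d (2 * L + 1)).eventually_cofinite_notMem] with x hx
    rw [mem_box_iff_supNorm_le, not_le] at hx
    have hAB := hL₁ L hL.2
    have hA : A ⊆ box d L := Finset.union_subset_left hAB
    have hB : B ⊆ box d L := Finset.union_subset_right hAB
    -- `A` and `B + x` are disjoint, so `A ∆ (B+x) = A ∪ (B+x)`
    have hdisj : Disjoint A (B.map (Site.shift x).toEmbedding) := by
      rw [Finset.disjoint_left]
      intro y hy hy'
      have h2 := two_le_supNorm_sub_of_mem_box d (by omega) (hA hy) (Finset.map_subset_map.2 hB hy')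
      rw [sub_self, Site.supNorm_eq_zero_iff.2 rfl] at h2
      omega
    have hunion : A ∆ B.map (Site.shift x).toEmbedding = A ∪ B.map (Site.shift x).toEmbedding :=
      Finset.symmDiff_eq_union hdisj
    rw [hunion]
    exact (plusCorr_union_shift_le d hβ hh hA hB (by omega)).trans_lt hL.1

end Literature.Probability.LatticeModels
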